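import Summits.CriticalPhenomena.CardyFormulaZ2.Theorems.CardyComplexConeParafermionToSLESixFamiliesDiamondDartPhaseClass
import Summits.CriticalPhenomena.CardyFormulaZ2.Theorems.CardyComplexConeParafermionToSLESixFamiliesDiamondDartPhaseArcs
import Summits.CriticalPhenomena.CardyFormulaZ2.Theorems.CardyComplexConeParafermionToSLESixFamiliesDiamondTraceTurn
import HarnessLib

/-!
# A boundary segment on the free / wired arc of a marked diamond sits counter-clockwise after / before the free start
# (line `potential-darboux-picard-diamond`, S1p `stub_boundaryDartPhase`, part 10)

Crux `ParafermionToSLESixFamilies` (stmt-CriticalPhenomena-11389), line `potential-darboux-picard-diamond`, stub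
`stub_boundaryDartPhase` (S1p). The continuum bookkeeping of `BoundaryDartPhase`: let `ℓ` be the counter-clockwise boundary
loop of the marked diamond in its frame (`exists_boundaryLoop_frame`) and `D.arc 1 = ℓ [s₁, t₁]`, `D.arc 0 = ℓ [t₁, s₁ + 2π]`
(`arcs_eq_of_loop`), so that `a = ℓ s₁` is the counter-clockwise START OF THE FREE ARC and `b = ℓ t₁` its end; write
`A = dLo kₐ + σₐ`, `B = dLo k_b + σ_b` for their boundary positions and `P = dLo k + sp` for that of the start `p` of an
oriented boundary segment `[p, q]` on side `k`. Then (`segment_orientation`, registered)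

  `[A ≤ P] - [B ≤ P] = [A < B] - [the segment lies on D.arc 0]`:

a free segment has its start in the cyclic interval `[A, B)`, a wired one in `[B, A)`. Proof: the midpoint of the segment
is a loop point `ℓ t_m` with `t_m ∈ (s₁, t₁)` (free) / `(t₁, s₁ + 2π)` (wired); boundary positions increase along the loop on
the period window cut at the corner `(-α, -β)` (`dPos_loop_strictMonoOn`), the cyclic order of `s₁, t_m, t₁` survives the
reduction to the window (`cycInd_of_reps`), and no mark lies between `p` and the midpoint. Also: the mark count and the side
index of `diamondTau` at `[p, q]` in these terms (`markCount_eq`, `sideIx_eq`).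
-/

noncomputable section

namespace Summit.CriticalPhenomena.CardyFormulaZ2.Cruxes.ParafermionToSLESixFamilies.PotentialDarbouxPicardDiamond

open Set Metric Complex
open Literature.Probability.RandomPlanarGeometry

/-! ## Positions of marks relative to a segment -/

/-- **No mark between the start and the midpoint of a boundary segment**: if a boundary point `a = dParam kₐ σₐ`
(frame) off the open segment `(p, q)` of side `k` has position in `(P, M]` (`P`, `M` the positions of `p` and of the
midpoint), contradiction. Stated as `[A ≤ M] = [A ≤ P]`. -/
theorem ind_le_mid_eq_ind_le_start {c : ℂ} {α β : ℝ} (hα : 0 < α) (hβ : 0 < β) {a p q : ℂ} {ka k : Fin 4} {σ sp sq : ℝ}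
    (hσ0 : 0 ≤ σ) (hσ1 : σ < dLen α β ka) (ha : dRot c a = dParam α β ka σ) (hsp0 : 0 ≤ sp) (hspq : sp < sq)
    (hsqL : sq ≤ dLen α β k) (hpk : dRot c p = dParam α β k sp) (hqk : dRot c q = dParam α β k sq)
    (hoff : a ∉ openSegment ℝ p q) :
    (if dLo α β ka + σ ≤ dLo α β k + (sp + sq) / 2 then 1 else 0 : ℤ) = (if dLo α β ka + σ ≤ dLo α β k + sp then 1 else 0 : ℤ) := by
  have hB : 0 < dBlock α β := by unfold dBlock; linarith
  have hLa := dLen_lt_dBlock hα hβ ka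
  have hLk := dLen_lt_dBlock hα hβ k
  by_cases hP : dLo α β ka + σ ≤ dLo α β k + sp
  · rw [if_pos hP, if_pos (by linarith)]
  · rw [if_neg hP]
    by_cases hM : dLo α β ka + σ ≤ dLo α β k + (sp + sq) / 2
    · exfalso
      push Not at hP
      -- the mark is in the block of side `k`
      have hkk : ka = k := by
        by_contra hne
        have hkv : ka.val ≠ k.val := fun h => hne (Fin.ext h)
        rw [dLo_eq_mul, dLo_eq_mul] at hP hM
        rcases Nat.lt_or_gt_of_ne hkv with hlt | hlt
        · have : (ka.val : ℝ) + 1 ≤ k.val := by exact_mod_cast hlt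
          nlinarith [mul_le_mul_of_nonneg_right this hB.le]
        · have : (k.val : ℝ) + 1 ≤ ka.val := by exact_mod_cast hlt
          nlinarith [mul_le_mul_of_nonneg_right this hB.le]
      subst hkk
      refine hoff (mem_openSegment_of_frame hpk hqk (a := a) ?_ ?_ ?_)
      · rw [ha]; exact Fk_dParam α β ka σ
      · rw [ha, Gk_dParam]; linarith
      · rw [ha, Gk_dParam]; linarith
    · rw [if_neg hM]

/-! ## The orientation of a segment relative to the free start -/

section Orientation

variable {D : DobrushinDomain} {c : ℂ} {α β : ℝ} (hα : 0 < α) (hβ : 0 < β) {ℓ : ℝ → ℂ}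
  (hper : ∀ s : ℝ, ℓ (s + 2 * Real.pi) = ℓ s)
  (hframe : ∀ (k : ℕ) (r : ℝ), 0 ≤ r → r ≤ 1 →
    (k % 4 = 0 → dRot c (ℓ ((k + r) * (Real.pi / 2))) = dParam α β 1 (r * dLen α β 1)) ∧
    (k % 4 = 1 → dRot c (ℓ ((k + r) * (Real.pi / 2))) = dParam α β 2 (r * dLen α β 2)) ∧
    (k % 4 = 2 → dRot c (ℓ ((k + r) * (Real.pi / 2))) = dParam α β 3 (r * dLen α β 3)) ∧
    (k % 4 = 3 → dRot c (ℓ ((k + r) * (Real.pi / 2))) = dParam α β 0 (r * dLen α β 0)))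
  {s₁ t₁ : ℝ} (hst : s₁ < t₁) (hts : t₁ < s₁ + 2 * Real.pi)
  (hmarks : (ℓ s₁ = D.pt 0 ∧ ℓ t₁ = D.pt 1) ∨ (ℓ s₁ = D.pt 1 ∧ ℓ t₁ = D.pt 0))
  (harc1 : D.arc 1 = ℓ '' Icc s₁ t₁) (harc0 : D.arc 0 = ℓ '' Icc t₁ (s₁ + 2 * Real.pi))
  {ka kb : Fin 4} {σa σb : ℝ} (hσa0 : 0 ≤ σa) (hσa1 : σa < dLen α β ka) (haM : dRot c (ℓ s₁) = dParam α β ka σa)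
  (hσb0 : 0 ≤ σb) (hσb1 : σb < dLen α β kb) (hbM : dRot c (ℓ t₁) = dParam α β kb σb)
  {i : Fin 2} {p q : ℂ} (hpq : IsBdrySegment D p q) (hsub : segment ℝ p q ⊆ D.arc i)
  {k : Fin 4} {sp sq : ℝ} (hsp0 : 0 ≤ sp) (hspq : sp < sq) (hsqL : sq ≤ dLen α β k)
  (hpk : dRot c p = dParam α β k sp) (hqk : dRot c q = dParam α β k sq)

/-- The window representative of a loop parameter: in `[-π/2, 3π/2)`, congruent modulo `2π`, same loop point. -/
theorem exists_rep (hper : ∀ s : ℝ, ℓ (s + 2 * Real.pi) = ℓ s) (x : ℝ) :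
    ∃ (x' : ℝ) (n : ℤ), x' ∈ Ico (-(Real.pi / 2)) (-(Real.pi / 2) + 2 * Real.pi) ∧ x' = x + n * (2 * Real.pi) ∧ ℓ x' = ℓ x := by
  have h2π := Real.two_pi_pos
  have hp : Function.Periodic ℓ (2 * Real.pi) := hper
  obtain ⟨hmem, z, hz⟩ := (toIcoMod_eq_iff h2π).1 (rfl : toIcoMod h2π (-(Real.pi / 2)) x = toIcoMod h2π (-(Real.pi / 2)) x)
  refine ⟨toIcoMod h2π (-(Real.pi / 2)) x, -z, hmem, ?_, ?_⟩
  · rw [eq_sub_of_add_eq hz.symm]; push_cast; ring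
  · have : toIcoMod h2π (-(Real.pi / 2)) x = x - z • (2 * Real.pi) := eq_sub_of_add_eq hz.symm
    rw [this]; exact hp.sub_zsmul_eq z

include hα hβ hper hframe hst hts hmarks harc1 harc0 hσa0 hσa1 haM hσb0 hσb1 hbM hpq hsub hsp0 hspq hsqL hpk hqk in
/-- **Orientation of a boundary segment relative to the free start**: `[A ≤ P] - [B ≤ P] = [A < B] - [i = 0]`. -/
theorem segment_orientation_core :
    ((if dLo α β ka + σa ≤ dLo α β k + sp then 1 else 0 : ℤ) - (if dLo α β kb + σb ≤ dLo α β k + sp then 1 else 0 : ℤ)) =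
      (if dLo α β ka + σa < dLo α β kb + σb then 1 else 0 : ℤ) - (if i = 0 then 1 else 0 : ℤ) := by
  have h2π := Real.two_pi_pos
  have hπ := Real.pi_pos
  -- the marks are off the open segment
  obtain ⟨hne, -, h0, h1, -⟩ := hpq
  have haoff : ℓ s₁ ∉ openSegment ℝ p q := by
    rcases hmarks with ⟨h, -⟩ | ⟨h, -⟩ <;> rw [h]
    exacts [h0, h1]
  have hboff : ℓ t₁ ∉ openSegment ℝ p q := by
    rcases hmarks with ⟨-, h⟩ | ⟨-, h⟩ <;> rw [h]
    exacts [h1, h0]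
  -- the midpoint of the segment
  set zm : ℂ := dRotInv c (dParam α β k ((sp + sq) / 2)) with hzm
  have hzm_rot : dRot c zm = dParam α β k ((sp + sq) / 2) := dRot_dRotInv c _
  have hzm_open : zm ∈ openSegment ℝ p q := by
    refine mem_openSegment_of_frame hpk hqk (a := zm) ?_ ?_ ?_
    · rw [hzm_rot]; exact Fk_dParam α β k _
    · rw [hzm_rot, Gk_dParam]; linarith
    · rw [hzm_rot, Gk_dParam]; linarith
  have hzm_arc : zm ∈ D.arc i := hsub (openSegment_subset_segment ℝ p q hzm_open)
  have hzm_a : zm ≠ ℓ s₁ := fun h => haoff (h ▸ hzm_open)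
  have hzm_b : zm ≠ ℓ t₁ := fun h => hboff (h ▸ hzm_open)
  -- window representatives and positions
  obtain ⟨sr, na, hsr, hsra, hlsr⟩ := exists_rep hper s₁
  obtain ⟨tr, nb, htr, htrb, hltr⟩ := exists_rep hper t₁
  have hwin : -(Real.pi / 2) + 2 * Real.pi = 3 * Real.pi / 2 := by ring
  have hmono := dPos_loop_strictMonoOn (c := c) hα hβ hper hframe
  have hA : dPos α β (dRot c (ℓ sr)) = dLo α β ka + σa := by rw [hlsr, haM, dPos_dParam hα hβ ka hσa0 hσa1]
  have hB : dPos α β (dRot c (ℓ tr)) = dLo α β kb + σb := by rw [hltr, hbM, dPos_dParam hα hβ kb hσb0 hσb1]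
  have hsrW : sr ∈ Ico (-(Real.pi / 2)) (3 * Real.pi / 2) := hwin ▸ hsr
  have htrW : tr ∈ Ico (-(Real.pi / 2)) (3 * Real.pi / 2) := hwin ▸ htr
  -- `A ≠ B`
  have hAB : dLo α β ka + σa ≠ dLo α β kb + σb := by
    intro h
    have hst' : sr = tr := hmono.injOn hsrW htrW (show dPos α β (dRot c (ℓ sr)) = dPos α β (dRot c (ℓ tr)) by rw [hA, hB, h])
    have : ℓ s₁ = ℓ t₁ := by rw [← hlsr, ← hltr, hst']
    have hne01 : D.pt 0 ≠ D.pt 1 := fun h' => absurd (D.pt_injective h') (by decide)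
    rcases hmarks with ⟨ha, hb⟩ | ⟨ha, hb⟩
    · exact hne01 (ha ▸ hb ▸ this)
    · exact hne01 (hb ▸ ha ▸ this).symm
  -- from the midpoint to the start
  have hAm := ind_le_mid_eq_ind_le_start hα hβ hσa0 hσa1 haM hsp0 hspq hsqL hpk hqk haoff
  have hBm := ind_le_mid_eq_ind_le_start hα hβ hσb0 hσb1 hbM hsp0 hspq hsqL hpk hqk hboff
  rw [← hAm, ← hBm]
  -- the loop parameter of the midpoint
  have hmid : ∀ {tm : ℝ}, ℓ tm = zm → ∀ (tmr : ℝ), tmr ∈ Ico (-(Real.pi / 2)) (-(Real.pi / 2) + 2 * Real.pi) → ℓ tmr = ℓ tm →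
      dPos α β (dRot c (ℓ tmr)) = dLo α β k + (sp + sq) / 2 := by
    intro tm htm tmr _ hl
    rw [hl, htm, hzm_rot, dPos_dParam hα hβ k (by linarith) (by linarith)]
  have hi : i = 0 ∨ i = 1 := by fin_cases i <;> simp
  rcases hi with rfl | rfl
  · -- wired: `t_m ∈ (t₁, s₁ + 2π)`
    rw [if_pos rfl]
    rw [harc0] at hzm_arc
    obtain ⟨tm, htmI, htm⟩ := hzm_arc
    have htm1 : t₁ < tm := lt_of_le_of_ne htmI.1 (by rintro rfl; exact hzm_b htm.symm)
    have htm2 : tm < s₁ + 2 * Real.pi := lt_of_le_of_ne htmI.2 (by rintro h; rw [h, hper] at htm; exact hzm_a htm.symm)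
    obtain ⟨tmr, nm, htmr, htmrm, hltmr⟩ := exists_rep hper tm
    have hM := hmid htm tmr htmr hltmr
    have htmrW : tmr ∈ Ico (-(Real.pi / 2)) (3 * Real.pi / 2) := hwin ▸ htmr
    have key := cycInd_of_reps htm1 htm2 (by linarith) htr htmr hsr htrb htmrm
      (show sr = s₁ + 2 * Real.pi + (na - 1 : ℤ) * (2 * Real.pi) by rw [hsra]; push_cast; ring)
    have e1 : (tr ≤ tmr) ↔ (dLo α β kb + σb ≤ dLo α β k + (sp + sq) / 2) := by rw [← hB, ← hM]; exact (hmono.le_iff_le htrW htmrW).symm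
    have e2 : (sr ≤ tmr) ↔ (dLo α β ka + σa ≤ dLo α β k + (sp + sq) / 2) := by rw [← hA, ← hM]; exact (hmono.le_iff_le hsrW htmrW).symm
    have e3 : (tr < sr) ↔ (dLo α β kb + σb < dLo α β ka + σa) := by rw [← hA, ← hB]; exact (hmono.lt_iff_lt htrW hsrW).symm
    simp only [e1, e2, e3] at key
    by_cases hlt : dLo α β ka + σa < dLo α β kb + σb
    · rw [if_pos hlt, if_neg (not_lt.2 hlt.le)] at *; linarith
    · rw [if_neg hlt, if_pos (lt_of_le_of_ne (not_lt.1 hlt) hAB.symm)] at *; linarith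
  · -- free: `t_m ∈ (s₁, t₁)`
    simp only [Fin.isValue, one_ne_zero, ↓reduceIte, sub_zero]
    rw [harc1] at hzm_arc
    obtain ⟨tm, htmI, htm⟩ := hzm_arc
    have htm1 : s₁ < tm := lt_of_le_of_ne htmI.1 (by rintro rfl; exact hzm_a htm.symm)
    have htm2 : tm < t₁ := lt_of_le_of_ne htmI.2 (by rintro rfl; exact hzm_b htm.symm)
    obtain ⟨tmr, nm, htmr, htmrm, hltmr⟩ := exists_rep hper tm
    have hM := hmid htm tmr htmr hltmr
    have htmrW : tmr ∈ Ico (-(Real.pi / 2)) (3 * Real.pi / 2) := hwin ▸ htmr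
    have key := cycInd_of_reps htm1 htm2 hts hsr htmr htr hsra htmrm htrb
    have e1 : (sr ≤ tmr) ↔ (dLo α β ka + σa ≤ dLo α β k + (sp + sq) / 2) := by rw [← hA, ← hM]; exact (hmono.le_iff_le hsrW htmrW).symm
    have e2 : (tr ≤ tmr) ↔ (dLo α β kb + σb ≤ dLo α β k + (sp + sq) / 2) := by rw [← hB, ← hM]; exact (hmono.le_iff_le htrW htmrW).symm
    have e3 : (sr < tr) ↔ (dLo α β ka + σa < dLo α β kb + σb) := by rw [← hA, ← hB]; exact (hmono.lt_iff_lt hsrW htrW).symm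
    simp only [e1, e2, e3] at key
    exact key

end Orientation

/-! ## The mark count and the side index at a segment -/

/-- **The mark count at the start of a segment** in terms of the positions of the two marks. -/
theorem markCount_eq {D : DobrushinDomain} {c : ℂ} {α β : ℝ} (hα : 0 < α) (hβ : 0 < β) {aM bM p : ℂ}
    (hmarks : (aM = D.pt 0 ∧ bM = D.pt 1) ∨ (aM = D.pt 1 ∧ bM = D.pt 0)) {ka kb k : Fin 4} {σa σb sp : ℝ}
    (hσa0 : 0 ≤ σa) (hσa1 : σa < dLen α β ka) (haM : dRot c aM = dParam α β ka σa) (hσb0 : 0 ≤ σb)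
    (hσb1 : σb < dLen α β kb) (hbM : dRot c bM = dParam α β kb σb) (hsp0 : 0 ≤ sp) (hsp1 : sp < dLen α β k)
    (hpk : dRot c p = dParam α β k sp) :
    (dMarkCount α β (dRot c (D.pt 0)) (dRot c (D.pt 1)) (dRot c p) : ℤ) =
      (if dLo α β ka + σa ≤ dLo α β k + sp then 1 else 0 : ℤ) + (if dLo α β kb + σb ≤ dLo α β k + sp then 1 else 0 : ℤ) := by
  have hP : dPos α β (dRot c p) = dLo α β k + sp := by rw [hpk, dPos_dParam hα hβ k hsp0 hsp1]
  have hA : dPos α β (dRot c aM) = dLo α β ka + σa := by rw [haM, dPos_dParam hα hβ ka hσa0 hσa1]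
  have hB : dPos α β (dRot c bM) = dLo α β kb + σb := by rw [hbM, dPos_dParam hα hβ kb hσb0 hσb1]
  unfold dMarkCount
  rcases hmarks with ⟨rfl, rfl⟩ | ⟨rfl, rfl⟩ <;> rw [hP, hA, hB] <;> push_cast <;> split_ifs <;> norm_num

/-- **The side index of a segment of side `k` is `k`.** -/
theorem sideIx_eq {c : ℂ} {α β : ℝ} {p q : ℂ} {k : Fin 4} {sp sq : ℝ} (hspq : sp < sq) (hpk : dRot c p = dParam α β k sp)
    (hqk : dRot c q = dParam α β k sq) : dSideIx (dRot c q - dRot c p) = (k : ℕ) := by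
  rw [hpk, hqk, dParam_sub]; exact dSideIx_dDir k (by linarith)

/-- **Orientation of a boundary segment relative to the free start** (registered helper of `stub_boundaryDartPhase`). See
the module docstring. -/
theorem segment_orientation : ∀ (D : DobrushinDomain) (c : ℂ) (α β : ℝ), 0 < α → 0 < β → ∀ (ℓ : ℝ → ℂ), (∀ s : ℝ, ℓ (s + 2 * Real.pi) = ℓ s) → (∀ (k : ℕ) (r : ℝ), 0 ≤ r → r ≤ 1 → (k % 4 = 0 → dRot c (ℓ ((k + r) * (Real.pi / 2))) = dParam α β 1 (r * dLen α β 1)) ∧ (k % 4 = 1 → dRot c (ℓ ((k + r) * (Real.pi / 2))) = dParam α β 2 (r * dLen α β 2)) ∧ (k % 4 = 2 → dRot c (ℓ ((k + r) * (Real.pi / 2))) = dParam α β 3 (r * dLen α β 3)) ∧ (k % 4 = 3 → dRot c (ℓ ((k + r) * (Real.pi / 2))) = dParam α β 0 (r * dLen α β 0))) → ∀ (s₁ t₁ : ℝ), s₁ < t₁ → t₁ < s₁ + 2 * Real.pi → ((ℓ s₁ = D.pt 0 ∧ ℓ t₁ = D.pt 1) ∨ (ℓ s₁ = D.pt 1 ∧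 ℓ t₁ = D.pt 0)) → D.arc 1 = ℓ '' Set.Icc s₁ t₁ → D.arc 0 = ℓ '' Set.Icc t₁ (s₁ + 2 * Real.pi) → ∀ (ka kb : Fin 4) (σa σb : ℝ), 0 ≤ σa → σa < dLen α β ka → dRot c (ℓ s₁) = dParam α β ka σa → 0 ≤ σb → σb < dLen α β kb → dRot c (ℓ t₁) = dParam α β kb σb → ∀ (i : Fin 2) (p q : ℂ), IsBdrySegment D p q → segment ℝ p q ⊆ D.arc i → ∀ (k : Fin 4) (sp sq : ℝ), 0 ≤ sp → sp < sq → sq ≤ dLen α β k → dRot c p = dParam α β k sp → dRot c q = dParam α β k sq → ((if dLo α β ka + σa ≤ dLo α β k + sp then 1 else 0 : ℤ) - (if dLo α β kb + σb ≤ dLo α β k + sp then 1 else 0 : ℤ)) = (if dLo α β ka + σa < dLo α β kb + σb then 1 else 0 : ℤ) - (if i = 0 then 1 else 0 : ℤ) := by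
  intro D c α β hα hβ ℓ hper hframe s₁ t₁ hst hts hmarks harc1 harc0 ka kb σa σb hσa0 hσa1 haM hσb0 hσb1 hbM i p q hpq hsub k sp sq hsp0
    hspq hsqL hpk hqk
  exact segment_orientation_core hα hβ hper hframe hst hts hmarks harc1 harc0 hσa0 hσa1 haM hσb0 hσb1 hbM hpq hsub hsp0 hspq hsqL hpk hqk

end Summit.CriticalPhenomena.CardyFormulaZ2.Cruxes.ParafermionToSLESixFamilies.PotentialDarbouxPicardDiamond

end
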